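import Summits.Langlands.Langlands.Theses.SenNullAlignment
import Summits.Langlands.Langlands.Theorems.IrreducibilityBySelfDualityReciprocityUpToIrreducibilityCorrespondsConj
import Literature.NumberTheory.PAdicHodge.SenOperator
import Literature.NumberTheory.Automorphic.SelfdualGL3AdjointLift

/-!
# Sketch — crux-ideate round 1, ideator 1, crux `SenNullAlignment.SectorComplement` (stmt-Langlands-16308)

First lemmas of the two idea cards `aligned-mirror-patching` (§1) and `functorial-shadows` (§2),
typed over existing declarations.  Nothing here asserts the crux, the target or the summit.
`def … : Prop` statements are the stubs-to-be; the `theorem`s are the X-seams, PROVED.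
-/

set_option linter.unusedVariables false
set_option linter.dupNamespace false

open scoped BigOperators Topology Manifold Classical MeasureTheory ProbabilityTheory Matrix InnerProductSpace ComplexConjugate ContinuousMap NumberField MatrixGroups
open Filter Set Function TopologicalSpace MeasureTheory
open NumberField IsDedekindDomain
open Literature.NumberTheory.Automorphic Literature.NumberTheory.GaloisRepresentations
open Literature.NumberTheory.PAdicHodge
open Summit.Langlands Summit.Langlands.Langlands.Theses.SenNullAlignment

noncomputable section

namespace Summit.Langlands.Langlands.Cruxes.SectorComplement.SenNullMirror

/-! ## §1  `aligned-mirror-patching` -/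

variable {K : Type} [Field K] [NumberField K] {ℓ : ℕ} [Fact ℓ.Prime]

/-- `ρ` is **aligned** at `v ∣ ℓ` (Galois side of the route's dichotomy): for every continuous
`τ : K_v → ℚ̄_ℓ` the `τ`-labelled Hodge–Tate weights of `ρ|_{Γ_{K_v}}` for Fontaine's PINNED datum
are `{0, 0}` ("all embeddings of `v` read weight one", after the twist making the common weight `0`). -/
def IsAlignedAt (ρ : FramedGaloisRep K (PadicAlgCl ℓ) 2) (v : HeightOneSpectrum (𝓞 K))
    (hv : ((ℓ : ℕ) : 𝓞 K) ∈ v.asIdeal) : Prop :=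
  ∀ τ : v.adicCompletion K →+* PadicAlgCl ℓ, Continuous τ →
    ρ.labelledHodgeTateWeightsAt v (fontainePstAdicCompletion v ℓ hv).algebra
      (fontainePstAdicCompletion v ℓ hv).𝔅 τ = {0, 0}

/-- `ρ` is **regular** at `v ∣ ℓ`: every `τ`-labelled Hodge–Tate multiset at `v` is multiplicity
free (the summit siblings' `Nodup` clause). -/
def IsRegularAt (ρ : FramedGaloisRep K (PadicAlgCl ℓ) 2) (v : HeightOneSpectrum (𝓞 K))
    (hv : ((ℓ : ℕ) : 𝓞 K) ∈ v.asIdeal) : Prop :=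
  ∀ τ : v.adicCompletion K →+* PadicAlgCl ℓ, Continuous τ →
    (ρ.labelledHodgeTateWeightsAt v (fontainePstAdicCompletion v ℓ hv).algebra
      (fontainePstAdicCompletion v ℓ hv).𝔅 τ).Nodup

/-- **First lemma (P2 of the card): Sen finiteness is FREE on the Galois side.**  A representation
that is de Rham at `v` for the pinned datum and aligned at `v` has finite inertia image at `v`
(de Rham ⇒ Hodge–Tate ⇒ `Θ` semisimple with eigenvalues the labelled weights `= 0` ⇒ `Θ = 0` ⇒
Sen 1973).  Stated relative to the tree's two named facts of Sen theory; the content to prove is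
the comparison "de Rham ⇒ Sen weights = labelled Hodge–Tate weights", flagged as missing in
`Literature/NumberTheory/PAdicHodge/SenOperator` (design notes). -/
def SenFiniteOfDeRhamAligned : Prop :=
  SenFiniteness → SenOperatorExistsUnique →
  ∀ (K : Type) [Field K] [NumberField K] (ℓ : ℕ) [Fact ℓ.Prime]
    (ρ : FramedGaloisRep K (PadicAlgCl ℓ) 2) (v : HeightOneSpectrum (𝓞 K))
    (hv : ((ℓ : ℕ) : 𝓞 K) ∈ v.asIdeal),
    (fontainePstAdicCompletion v ℓ hv).IsDeRhamFramed (ρ.toLocal v) → IsAlignedAt ρ v hv →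
      ((fun g => ρ.toLocal v g) ''
        (absInertia (v.adicCompletion K) : Set (Field.absoluteGaloisGroup (v.adicCompletion K)))).Finite

/-- **K1+K2+K3 composite, weak form (the sector theorem of the card): direction (B), a.e. form, on the
ALIGNED odd-Hilbert sector.**  For `K` totally real, `ρ : Γ_K → GL₂(ℚ̄_ℓ)` irreducible, totally odd,
a.e. unramified, de Rham above `ℓ`, and every `v ∣ ℓ` aligned or regular: `ρ` is Satake–Frobenius
compatible a.e. with a cuspidal L-algebraic `π` that is HOLOMORPHIC of some weight `(k, w)` with totally
odd sign (the two clauses are X's hypotheses verbatim).  As typed (no residual-modularity / adequacy /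
genericity-at-aligned-places hypotheses) this is a consequence of the summit used toward the summit; the
card's lifting theorem K1 is its residually-modular, `ℓ` totally split, generic sub-case. -/
def AlignedWeakAutomorphyHol : Prop :=
  ∀ (K : Type) [Field K] [NumberField K], IsTotallyReal K →
    ∀ (hcpt : isCompact_glFiniteIntegralLevel 2 K) (ℓ : ℕ) [Fact ℓ.Prime] (ι : PadicAlgCl ℓ ≃+* ℂ)
      (ρ : FramedGaloisRep K (PadicAlgCl ℓ) 2),
      ρ.toGaloisRep.IsIrreducible → ρ.IsOdd →
      (∀ᶠ v : HeightOneSpectrum (𝓞 K) in cofinite, ρ.IsUnramifiedAt v) →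
      (∀ (v : HeightOneSpectrum (𝓞 K)) (hv : ((ℓ : ℕ) : 𝓞 K) ∈ v.asIdeal),
          (fontainePstAdicCompletion v ℓ hv).IsDeRhamFramed (ρ.toLocal v) ∧
            (IsAlignedAt ρ v hv ∨ IsRegularAt ρ v hv)) →
      ∃ (π : CuspidalAutomorphicRepData 2 K hcpt) (k : (K →+* ℂ) → ℕ) (w : ℤ),
        π.1.IsLAlgebraic ∧
        π.1.HasInfinityType (fun β : K →+* ℂ => ({(⟨((k β : ℂ) - 1 - w) / 2, (1 - (k β : ℂ) - w) / 2, (k β : ℤ) - 1, by push_cast; ring⟩ : Literature.NumberTheory.Automorphic.ArchWeight), (⟨((k β : ℂ) - 1 - w) / 2, (1 - (k β : ℂ) - w) / 2, (k β : ℤ) - 1, by push_cast; ring⟩ : Literature.NumberTheory.Automorphic.ArchWeight).swap} : Multiset Literature.NumberTheory.Automorphic.ArchWeight)) ∧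
        (∀ (u : NumberField.InfinitePlace K), ∀ φ ∈ π.1.W, Literature.NumberTheory.Automorphic.rightTranslation (Literature.NumberTheory.Automorphic.AdelicGroupData.gl 2 K) (Matrix.GeneralLinearGroup.scalar (Fin 2) (Units.map (MonoidHom.inl (NumberField.InfiniteAdeleRing K) (IsDedekindDomain.FiniteAdeleRing (NumberField.RingOfIntegers K) K) : NumberField.InfiniteAdeleRing K →* NumberField.AdeleRing (NumberField.RingOfIntegers K) K) (Units.map (MonoidHom.mulSingle (fun u' : NumberField.InfinitePlace K => u'.Completion) u : u.Completion →* NumberField.InfiniteAdeleRing K) (-1)))) φ + φ ∈ π.1.W') ∧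
        ∀ᶠ v : HeightOneSpectrum (𝓞 K) in cofinite, SatakeFrobCompatibleAt ι π.1 ρ v

/-- **Typed direction (B) on the aligned odd-Hilbert sector, for the reciprocity data `RD`** —
`Corresponds RD ι π ρ` at EVERY finite place (the summit's own format). -/
def AlignedTypedAutomorphy (K : Type) [Field K] [NumberField K] (RD : ReciprocityData K) : Prop :=
  ∀ (hcpt : isCompact_glFiniteIntegralLevel 2 K) (ℓ : ℕ) [Fact ℓ.Prime] (ι : PadicAlgCl ℓ ≃+* ℂ)
    (ρ : FramedGaloisRep K (PadicAlgCl ℓ) 2),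
    ρ.toGaloisRep.IsIrreducible → ρ.IsOdd →
    (∀ᶠ v : HeightOneSpectrum (𝓞 K) in cofinite, ρ.IsUnramifiedAt v) →
    (∀ (v : HeightOneSpectrum (𝓞 K)) (hv : ((ℓ : ℕ) : 𝓞 K) ∈ v.asIdeal),
        (fontainePstAdicCompletion v ℓ hv).IsDeRhamFramed (ρ.toLocal v) ∧
          (IsAlignedAt ρ v hv ∨ IsRegularAt ρ v hv)) →
    ∃ π : CuspidalAutomorphicRepData 2 K hcpt, π.1.IsLAlgebraic ∧ Corresponds RD ι π.1 ρ

/-- **The X-seam, PROVED (P1 of the card): `OddHilbertReciprocity` is what turns the weak mirror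
theorem into the summit's typed clause (B) on the aligned sector.**  X supplies, for its datum `RD`,
some `ρ'` with `Corresponds RD ι π ρ'` for the holomorphic odd `π` produced by (B)-weak; the landed
weak-to-strong lemma `corresponds_of_exists_corresponds` (Chebotarev + Brauer–Nesbitt + frame change)
transports it to the given irreducible `ρ`.  No other source of local–global compatibility exists for
partial weight one `π`. -/
theorem alignedTyped_of_oddHilbert (hX : OddHilbertReciprocity) (hB : AlignedWeakAutomorphyHol) :
    ∀ (K : Type) [Field K] [NumberField K], IsTotallyReal K →
      ∃ RD : ReciprocityData K, AlignedTypedAutomorphy K RD := by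
  intro K _ _ hK
  obtain ⟨RD, hRD⟩ := hX K hK
  refine ⟨RD, ?_⟩
  intro hcpt ℓ _ ι ρ hirr hodd hur hloc
  obtain ⟨π, k, w, hL, hhol, hsgn, hae⟩ := hB K hK hcpt ℓ ι ρ hirr hodd hur hloc
  obtain ⟨ρ', -, -, hcorr⟩ := hRD hcpt π k w hL hhol hsgn ℓ ι
  exact ⟨π, hL, Summit.Langlands.Langlands.Theorems.ReciprocityUpToIrreducibility.corresponds_of_exists_corresponds hirr hae ⟨ρ', hcorr⟩⟩

/-- Position check (costume test of the disprover, §5 of `Cruxes/SectorComplement/NOTES.md` L3):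
the summit implies the typed mirror sector — it is a CONSEQUENCE of `Langlands` used toward
`Langlands` (`wuc`-admissible), not a restatement of the crux. -/
theorem alignedTyped_of_langlands (hL : _root_.Langlands) (K : Type) [Field K] [NumberField K]
    (RD : ReciprocityData K) : AlignedTypedAutomorphy K RD := by
  intro hcpt ℓ _ ι ρ hirr _hodd hur hloc
  obtain ⟨-, h⟩ := hL K
  have hB : GaloisToAutomorphic 2 RD hcpt := (h RD 2 two_pos hcpt).2
  exact hB ℓ ι ρ hirr ⟨hur, fun v hv => (hloc v hv).1⟩

/-! ## §2  `functorial-shadows` -/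

/-- **(A), a.e. form, for the TWISTED ADJOINT SHADOW of the odd-Hilbert plane.**  If `π` is in X's
sector (L-algebraic cuspidal on `GL₂/K`, `K` totally real, holomorphic of weight `(k, w)`, totally odd)
and `P` is a cuspidal L-algebraic representation of `GL₃(𝔸_K)` whose Satake parameters are a.e. those of
`Ad(π) ⊗ ν` (`adParams`, the carrier of the tree's `GelbartJacquet_adjoint_lift` /
`Ramakrishnan2014_selfdualGL3_adjointLift`), then `P` has an irreducible Satake–Frobenius compatible
`ρ₃ : Γ_K → GL₃(ℚ̄_ℓ)` for every `ℓ, ι` — namely `Ad(ρ_{π,ι}) ⊗ ν_ι`. -/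
def AdjointShadowWeakA : Prop :=
  ∀ (K : Type) [Field K] [NumberField K], IsTotallyReal K →
    ∀ (hcpt2 : isCompact_glFiniteIntegralLevel 2 K) (hcpt3 : isCompact_glFiniteIntegralLevel 3 K)
      (π : CuspidalAutomorphicRepData 2 K hcpt2) (k : (K →+* ℂ) → ℕ) (w : ℤ),
      π.1.IsLAlgebraic →
      π.1.HasInfinityType (fun β : K →+* ℂ => ({(⟨((k β : ℂ) - 1 - w) / 2, (1 - (k β : ℂ) - w) / 2, (k β : ℤ) - 1, by push_cast; ring⟩ : Literature.NumberTheory.Automorphic.ArchWeight), (⟨((k β : ℂ) - 1 - w) / 2, (1 - (k β : ℂ) - w) / 2, (k β : ℤ) - 1, by push_cast; ring⟩ : Literature.NumberTheory.Automorphic.ArchWeight).swap} : Multiset Literature.NumberTheory.Automorphic.ArchWeight)) →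
      (∀ (u : NumberField.InfinitePlace K), ∀ φ ∈ π.1.W, Literature.NumberTheory.Automorphic.rightTranslation (Literature.NumberTheory.Automorphic.AdelicGroupData.gl 2 K) (Matrix.GeneralLinearGroup.scalar (Fin 2) (Units.map (MonoidHom.inl (NumberField.InfiniteAdeleRing K) (IsDedekindDomain.FiniteAdeleRing (NumberField.RingOfIntegers K) K) : NumberField.InfiniteAdeleRing K →* NumberField.AdeleRing (NumberField.RingOfIntegers K) K) (Units.map (MonoidHom.mulSingle (fun u' : NumberField.InfinitePlace K => u'.Completion) u : u.Completion →* NumberField.InfiniteAdeleRing K) (-1)))) φ + φ ∈ π.1.W') →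
      ∀ (P : CuspidalAutomorphicRepData 3 K hcpt3) (ν : HeckeCharacter K), P.1.IsLAlgebraic →
        (∀ᶠ v : HeightOneSpectrum (𝓞 K) in cofinite, ∀ β : Multiset ℂ,
            π.1.HasSatakeParamAt v β →
              ν.IsUnramifiedAt v ∧
                P.1.HasSatakeParamAt v ((adParams β).map fun c => ν.valueAtUniformizer v * c)) →
        ∀ (ℓ : ℕ) [Fact ℓ.Prime] (ι : PadicAlgCl ℓ ≃+* ℂ),
          ∃ ρ₃ : FramedGaloisRep K (PadicAlgCl ℓ) 3,
            ρ₃.toGaloisRep.IsIrreducible ∧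
              ∀ᶠ v : HeightOneSpectrum (𝓞 K) in cofinite, SatakeFrobCompatibleAt ι P.1 ρ₃ v

/-- **(A), typed form, for the twisted adjoint shadow, for the reciprocity data `RD`**: the same with
`IsGeometricFramed RD ρ₃ ∧ Corresponds RD ι P ρ₃` — local–global compatibility at EVERY finite place,
which needs X (LGC for `π`) + local functoriality of the Gelbart–Jacquet lift at every place (K1 of the
card) + tensoriality of the pinned Fontaine datum and of the Grothendieck–Deligne recipe. -/
def AdjointShadowTypedA (K : Type) [Field K] [NumberField K] (RD : ReciprocityData K) : Prop :=
  ∀ (hcpt2 : isCompact_glFiniteIntegralLevel 2 K) (hcpt3 : isCompact_glFiniteIntegralLevel 3 K)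
    (π : CuspidalAutomorphicRepData 2 K hcpt2) (k : (K →+* ℂ) → ℕ) (w : ℤ),
    π.1.IsLAlgebraic →
    π.1.HasInfinityType (fun β : K →+* ℂ => ({(⟨((k β : ℂ) - 1 - w) / 2, (1 - (k β : ℂ) - w) / 2, (k β : ℤ) - 1, by push_cast; ring⟩ : Literature.NumberTheory.Automorphic.ArchWeight), (⟨((k β : ℂ) - 1 - w) / 2, (1 - (k β : ℂ) - w) / 2, (k β : ℤ) - 1, by push_cast; ring⟩ : Literature.NumberTheory.Automorphic.ArchWeight).swap} : Multiset Literature.NumberTheory.Automorphic.ArchWeight)) →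
    (∀ (u : NumberField.InfinitePlace K), ∀ φ ∈ π.1.W, Literature.NumberTheory.Automorphic.rightTranslation (Literature.NumberTheory.Automorphic.AdelicGroupData.gl 2 K) (Matrix.GeneralLinearGroup.scalar (Fin 2) (Units.map (MonoidHom.inl (NumberField.InfiniteAdeleRing K) (IsDedekindDomain.FiniteAdeleRing (NumberField.RingOfIntegers K) K) : NumberField.InfiniteAdeleRing K →* NumberField.AdeleRing (NumberField.RingOfIntegers K) K) (Units.map (MonoidHom.mulSingle (fun u' : NumberField.InfinitePlace K => u'.Completion) u : u.Completion →* NumberField.InfiniteAdeleRing K) (-1)))) φ + φ ∈ π.1.W') →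
    ∀ (P : CuspidalAutomorphicRepData 3 K hcpt3) (ν : HeckeCharacter K), P.1.IsLAlgebraic →
      (∀ᶠ v : HeightOneSpectrum (𝓞 K) in cofinite, ∀ β : Multiset ℂ,
          π.1.HasSatakeParamAt v β →
            ν.IsUnramifiedAt v ∧
              P.1.HasSatakeParamAt v ((adParams β).map fun c => ν.valueAtUniformizer v * c)) →
      ∀ (ℓ : ℕ) [Fact ℓ.Prime] (ι : PadicAlgCl ℓ ≃+* ℂ),
        ∃ ρ₃ : FramedGaloisRep K (PadicAlgCl ℓ) 3,
          ρ₃.toGaloisRep.IsIrreducible ∧ IsGeometricFramed RD ρ₃ ∧ Corresponds RD ι P.1 ρ₃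

/-- Position check: the typed shadow statement is a consequence of the summit (direction (A) at
`n = 3`), hence `wuc`-admissible and not a restatement of the crux. -/
theorem adjointShadowTyped_of_langlands (hL : _root_.Langlands) (K : Type) [Field K] [NumberField K]
    (RD : ReciprocityData K) : AdjointShadowTypedA K RD := by
  intro hcpt2 hcpt3 π k w _ _ _ P ν hP _ ℓ _ ι
  obtain ⟨-, h⟩ := hL K
  have hA : AutomorphicToGalois 3 RD hcpt3 := (h RD 3 (by norm_num) hcpt3).1
  obtain ⟨ρ₃, hirr, hgeo, hcorr, -⟩ := hA P hP ℓ ι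
  exact ⟨ρ₃, hirr, hgeo, hcorr⟩

end Summit.Langlands.Langlands.Cruxes.SectorComplement.SenNullMirror

end
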